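import Literature.MathematicalPhysics.QuantumFieldTheory.Balaban1983to89.B4Thm112RegionLpHolderAll
import Literature.MathematicalPhysics.QuantumFieldTheory.Balaban1983to89.B4Thm110RegionAllF

/-!
# `Balaban1983to89.B4Thm112RegionAllF` — [Balaban1983RegularityDecay] THEOREM p. 573, (1.11)–(1.12): THE δG CLAUSE,
# DERIVATIVE AND HÖLDER MEMBERS, FOR A GENERAL PAIR `Ω ⊂ Ω₀` UNDER `R₀`, «FOR AN ARBITRARY FUNCTION f» — the print's
# cube summation (p. 575 ¶1) applied to r01 g7's unit-block theorems

statement-level skeleton of published theorems with citation tags; proofs where landed; nothing here is a claim about the Yang–Mills mass gap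

CITATION HEADER.  T. Bałaban, *Regularity and decay of lattice Green's functions*, Commun. Math. Phys. **89** (1983)
571–597, doi:10.1007/bf01214744 [Balaban1983RegularityDecay] (cell paper B4; held text
`paper:balaban1983-cmp89-regularity-decay`, journal page = PDF page + 570; pp. 573, 575, 579).  Unit `lit-balaban-r01`
gen 8 (B4 fold owner), HOME `run/shared/lean/pub/lit-balaban/`, SKELETON row **B4.Thm@573** (file 1 of the r01 g8
programme «the typed Theorem on the general-region-pair family»).  Imports: r01 g7 `B4Thm112RegionLpHolderAll`
(`thm112_deriv_region_unitBlock`, `thm112_holder_region_all_unitBlock`: the δG derivative / Hölder members for `f`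
supported in one unit block) and r04 g8 `B4Thm110RegionAllF` (the cube-summation engine `cubeSum_bound₂` and the value
member `thm112_value_region_allF`, which this file complements).

WHAT IS PRINTED (p. 573, verbatim). «… for an arbitrary function f: Ω → R^N … If Ω ⊂ Ω₀, then for δG_k(Ω,Ω₀,A) … we have
the inequalities (1.9), (1.10) (with the same restrictions on x, x′) with the additional factor
exp(−δ₀ dist(supp f, Ω^c) − δ₀ dist(supp f, Ω^c)) (1.12) on the right sides»; p. 575 ¶1 «it is sufficient to prove the
theorem for function f with supports in unit cubes»; p. 579 (the mechanism of (1.12), one distance per argument).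

WHAT THIS FILE PROVES (kernel, sorry-free).
* **`thm112_deriv_region_allF`** — (1.10)·(1.12) for `δG_k`, DERIVATIVE member, general pair `Ω ⊂ Ω₀` under `R₀`
  (radius `K(d+3)+1`, the bond `x, x+e_μ ∈ Ω`), for an ARBITRARY `f : Ω₀ → ℝ^N` vanishing off a support predicate `P` at
  `ℓ^∞`-distance `≥ D` from `x`, `≥ D₁` from `Ω₀∖Ω`, `x` at distance `≥ D₀` from `Ω₀∖Ω` (fine units):
  `|(D^η_{A,μ}G_k(Ω,A)(f|_Ω))(x)_i − (D^η_{A,μ}G_k(Ω₀,A)f)(x)_i| ≤ c₀·e^{−(D₀+D₁)/(2nK)}·e^{−D/(4nK)}·‖f‖_∞`.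
* **`thm112_holder_region_all_allF`** — (1.9)·(1.12) for `δG_k`, HÖLDER member, ALL pairs `x ≠ x′` (`0 ≤ α < 1`, `K ≥ 16`,
  `R₀` radius `K(d+4)` at both points, any nearest-neighbour contour `Γ` of length `≤ (d+1)|x′−x|_∞` in the sup-ball), for
  an ARBITRARY `f` at `ℓ^∞`-distance `≥ D` from both points, `0 ≤ D₀ ≤` the distances of `x`, `x′` to `Ω₀∖Ω`,
  `0 ≤ D₁ ≤ dist(supp f, Ω₀∖Ω)`:
  `(η⁻¹/|x−x′|_∞)^α·|(U(A(Γ))(D^η_{A,μ}u_Ω)(x′) − (D^η_{A,μ}u_Ω)(x) − (U(A(Γ))(D^η_{A,μ}u₀)(x′) − (D^η_{A,μ}u₀)(x)))_i|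
   ≤ c₀·e^{−(D₀+D₁)/(2nK)}·e^{−D/(4nK)}·‖f‖_∞` (`u_Ω = G_k(Ω,A)(f|_Ω)`, `u₀ = G_k(Ω₀,A)f`).
METHOD.  Exactly r04's §4: the δG probe is an additive functional of `f`; the unit-block theorem at the support predicate
`blk = y₀ ∧ P` (so the block pieces inherit `D₀`, `D₁`, whose factor `e^{−(D₀+D₁)/(2nK)}` rides in the constant); the
two-base-point summation `cubeSum_bound₂` at modulus `2K`.
HONEST SCOPE.  Exactly r01 g7's (`B4Thm112RegionLpDeriv`, `B4Thm112RegionLpHolder(All)`): abelian one-parameter flow,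
component field, `K` chosen after `(d, N, flow, L, windows)`, `a_k = B1.aSeq a L k`, distances in the `ℓ^∞` metric of the
fine lattice (`D/n` = the print's distance), componentwise values, distances to `Ω₀ ∖ Ω ⊆ Ω^c` (stronger than the print's
`Ω^c`); the rate halves in the summation (constants are existential in the print).  Theorems only; no definition, no
`Prop` fact, no `sorry`; axioms standard.
-/

namespace Literature.MathematicalPhysics.QuantumFieldTheory.Balaban1983to89.B4Thm112RegionAllF

open Literature.MathematicalPhysics.QuantumFieldTheory.Balaban1983to89
open Literature.MathematicalPhysics.QuantumFieldTheory.Balaban1983to89.B4Reflection242 (blk)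
open Literature.MathematicalPhysics.QuantumFieldTheory.Balaban1983to89.B4GaugeCovariance
open Literature.MathematicalPhysics.QuantumFieldTheory.Balaban1983to89.B4Lower18 (fineDom mem_fineDom IsBlockUnion)
open Literature.MathematicalPhysics.QuantumFieldTheory.Balaban1983to89.B4Lower18Regular (e1)
open Literature.MathematicalPhysics.QuantumFieldTheory.Balaban1983to89.B4Lemma21Region (regionOp regionDeriv)
open Literature.MathematicalPhysics.QuantumFieldTheory.Balaban1983to89.B4WalkRouteRegion (rpos)
open Literature.MathematicalPhysics.QuantumFieldTheory.Balaban1983to89.B4RegionCubeCarrier (incl inReg)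
open Literature.MathematicalPhysics.QuantumFieldTheory.Balaban1983to89.B4ContourShift (supNorm supNorm_nonneg)
open Literature.MathematicalPhysics.QuantumFieldTheory.Balaban1983to89.B4Lemma22HolderBox (IsNNChain)
open Literature.MathematicalPhysics.QuantumFieldTheory.Balaban1983to89.B4Eq221L2FactorRegion (acBond)
open Literature.MathematicalPhysics.QuantumFieldTheory.Balaban1983to89.B4Ineq110LpChain (lpv)
open Literature.MathematicalPhysics.QuantumFieldTheory.Balaban1983to89.B4Lemma22EtaBox (vol)
open Literature.MathematicalPhysics.QuantumFieldTheory.Balaban1983to89.B4Thm110RegionLp (lpv_two_le_unitBlock)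
open Literature.MathematicalPhysics.QuantumFieldTheory.Balaban1983to89.B4Thm112RegionLpDeriv (thm112_deriv_region)
open Literature.MathematicalPhysics.QuantumFieldTheory.Balaban1983to89.B4Thm112RegionLpHolderAll
  (thm112_holder_region_all)
open Literature.MathematicalPhysics.QuantumFieldTheory.Balaban1983to89.B4Thm110RegionAllF (cubeSum_bound₂)
open Literature.MathematicalPhysics.QuantumFieldTheory.Balaban1983to89.B4Sect5Proof (latticeConst latticeConst_nonneg)
open scoped Matrix

noncomputable section

variable {d : ℕ} {ι : Type} [Fintype ι] [DecidableEq ι]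

/-! ## §1  Additivity of the two δG probes in `f` -/

omit [DecidableEq ι] in
/-- additivity in `f` of the δG probe seen through restriction: `(N_Ω(f|_Ω))(x)_i − (N₀f)(ιx)_i`. [folklore] -/
private theorem pair_expr_sum {Y Y₀ : Type} [Fintype Y] [Fintype Y₀] (NΩ : Matrix (Y × ι) (Y × ι) ℝ)
    (N₀ : Matrix (Y₀ × ι) (Y₀ × ι) ℝ) (j : Y → Y₀) (x : Y) (i : ι) {σ : Type} (s : Finset σ)
    (g : σ → (Y₀ × ι → ℝ)) :
    ((NΩ *ᵥ fun q : Y × ι => (∑ y ∈ s, g y) (j q.1, q.2)) (x, i) - (N₀ *ᵥ ∑ y ∈ s, g y) (j x, i))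
      = ∑ y ∈ s, ((NΩ *ᵥ fun q : Y × ι => g y (j q.1, q.2)) (x, i) - (N₀ *ᵥ g y) (j x, i)) := by
  have h1 : (fun q : Y × ι => (∑ y ∈ s, g y) (j q.1, q.2)) = ∑ y ∈ s, fun q : Y × ι => g y (j q.1, q.2) := by
    funext q; simp [Finset.sum_apply]
  rw [h1, Matrix.mulVec_sum, Matrix.mulVec_sum, Finset.sum_apply, Finset.sum_apply, ← Finset.sum_sub_distrib]

omit [DecidableEq ι] in
/-- additivity in `f` of the Hölder δG probe
`w·((T(N_Ω(f|_Ω))(x′) − (N_Ω(f|_Ω))(x) − (T(N₀f)(ιx′) − (N₀f)(ιx)))_i)`. [folklore] -/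
private theorem holder_pair_expr_sum {Y Y₀ : Type} [Fintype Y] [Fintype Y₀] (w : ℝ) (T : Matrix ι ι ℝ)
    (NΩ : Matrix (Y × ι) (Y × ι) ℝ) (N₀ : Matrix (Y₀ × ι) (Y₀ × ι) ℝ) (j : Y → Y₀) (x x' : Y) (i : ι)
    {σ : Type} (s : Finset σ) (g : σ → (Y₀ × ι → ℝ)) :
    w * ((T *ᵥ fld (NΩ *ᵥ fun q : Y × ι => (∑ y ∈ s, g y) (j q.1, q.2)) x'
          - fld (NΩ *ᵥ fun q : Y × ι => (∑ y ∈ s, g y) (j q.1, q.2)) x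
          - (T *ᵥ fld (N₀ *ᵥ ∑ y ∈ s, g y) (j x') - fld (N₀ *ᵥ ∑ y ∈ s, g y) (j x))) i)
      = ∑ y ∈ s, w * ((T *ᵥ fld (NΩ *ᵥ fun q : Y × ι => g y (j q.1, q.2)) x'
          - fld (NΩ *ᵥ fun q : Y × ι => g y (j q.1, q.2)) x
          - (T *ᵥ fld (N₀ *ᵥ g y) (j x') - fld (N₀ *ᵥ g y) (j x))) i) := by
  classical
  have h1 : (fun q : Y × ι => (∑ y ∈ s, g y) (j q.1, q.2)) = ∑ y ∈ s, fun q : Y × ι => g y (j q.1, q.2) := by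
    funext q; simp [Finset.sum_apply]
  have h2 : ∀ z, fld (NΩ *ᵥ ∑ y ∈ s, fun q : Y × ι => g y (j q.1, q.2)) z
      = ∑ y ∈ s, fld (NΩ *ᵥ fun q : Y × ι => g y (j q.1, q.2)) z := by
    intro z; funext k; simp [fld, Matrix.mulVec_sum, Finset.sum_apply]
  have h3 : ∀ z, fld (N₀ *ᵥ ∑ y ∈ s, g y) z = ∑ y ∈ s, fld (N₀ *ᵥ g y) z := by
    intro z; funext k; simp [fld, Matrix.mulVec_sum, Finset.sum_apply]
  rw [h1, h2, h2, h3, h3, Matrix.mulVec_sum, Matrix.mulVec_sum, ← Finset.sum_sub_distrib, ← Finset.sum_sub_distrib,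
    ← Finset.sum_sub_distrib, Finset.sum_apply, Finset.mul_sum]

/-! ## §2  (1.10)·(1.12) for `δG_k`, derivative member, for an ARBITRARY `f` -/

/-- **THEOREM (1.11)–(1.12), DERIVATIVE member, GENERAL PAIR `Ω ⊂ Ω₀` UNDER `R₀`, ARBITRARY `f`** — r01 g7's
`B4Thm112RegionLpDeriv.thm112_deriv_region` freed of the bookkeeping datum `‖f‖_{2,η} ≤ V‖f‖_∞` by the cube summation
(p. 575 ¶1; the fixed boundary factor `e^{−(D₀+D₁)/(2nK)}` carried in the constant): there are `K ≥ 8` (`8 ∣ K`) and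
`c₀ > 0` such that for every `(c, β)` there is `e₁ > 0` with: for every `k ≥ 1`, `a ∈ [a₋,a₊]`, `m² ∈ [0,m²₊]`, every
pair `Ω ⊆ Ω₀` of finite unions of `K`-blocks, every field regular (1.7) on `Ω₀` with `0 < e ≤ e₁`, every direction `μ`
and site `x` with `x, x+e_μ ∈ Ω` and the `R₀` restriction (radius `K(d+3)+1`), EVERY `f : Ω₀ → ℝ^N` vanishing off a
predicate `P` at `ℓ^∞`-distance `≥ D` from `x` and `≥ D₁` from `Ω₀∖Ω`, `x` at distance `≥ D₀` from `Ω₀∖Ω` (fine units):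
`|(D^η_{A,μ}G_k(Ω,A)(f|_Ω))(x)_i − (D^η_{A,μ}G_k(Ω₀,A)f)(x)_i| ≤ c₀·e^{−(D₀+D₁)/(2nK)}·e^{−D/(4nK)}·‖f‖_∞` — «(1.10)
[for δG_k(Ω,Ω₀,A)] … with the additional factor (1.12)», for an arbitrary `f`.
[cite: Balaban1983RegularityDecay, Theorem p.573 (1.10)–(1.12); §2 ¶1 p.575; proof p.579] -/
theorem thm112_deriv_region_allF (F : OrthFlow ι) {ℓ₁ : ℝ} (hℓ₁ : 0 ≤ ℓ₁)
    (hLip : ∀ t (v : ι → ℝ), ((F.U t - 1) *ᵥ v) ⬝ᵥ ((F.U t - 1) *ᵥ v) ≤ (ℓ₁ * t) ^ 2 * (v ⬝ᵥ v))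
    (d ℓ : ℕ) (hℓ : 1 ≤ ℓ) (amin aplus m2plus : ℝ) (ha : 0 < amin) :
    ∃ K : ℕ, 8 ≤ K ∧ 8 ∣ K ∧ ∃ c₀ : ℝ, 0 < c₀ ∧ ∀ (creg β : ℝ), 0 ≤ creg → 0 < β →
      ∃ e₁ : ℝ, 0 < e₁ ∧ ∀ (k : ℕ), 1 ≤ k → ∀ (hn : 1 ≤ (ℓ + 1) ^ k) (a m2 : ℝ),
      amin ≤ a → a ≤ aplus → 0 ≤ m2 → m2 ≤ m2plus →
      ∀ (Ω₀c Ωc : Finset (Fin (d + 1) → ℤ)), IsBlockUnion K Ω₀c → IsBlockUnion K Ωc → ∀ (hsub : Ωc ⊆ Ω₀c)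
      (Ac : (Fin (d + 1) → ℤ) → Fin (d + 1) → ℝ) (e : ℝ), 0 < e → e ≤ e₁ →
        (∀ x ∈ fineDom ((ℓ + 1) ^ k) Ω₀c, ∀ μ ν : Fin (d + 1),
          |Ac (x + e1 μ) ν - Ac x ν| ≤ creg * e ^ (β - 1) / ((ℓ + 1) ^ k : ℕ)) →
      ∀ (μ : Fin (d + 1)) (x : ↥(fineDom ((ℓ + 1) ^ k) Ωc)), x.1 + e1 μ ∈ fineDom ((ℓ + 1) ^ k) Ωc →
        (∀ y : Fin (d + 1) → ℤ, (∀ ν, |y ν - blk ((ℓ + 1) ^ k) x.1 ν| ≤ (K : ℤ) * (d + 3) + 1) → y ∈ Ωc) →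
      ∀ (P : ↥(fineDom ((ℓ + 1) ^ k) Ω₀c) → Prop) (D D₀ D₁ : ℝ),
        (∀ x', P x' → ∃ ν, D ≤ |rpos ((ℓ + 1) ^ k) Ω₀c (incl hn hsub x) ν - rpos ((ℓ + 1) ^ k) Ω₀c x' ν|) →
        (∀ x₁ : ↥(fineDom ((ℓ + 1) ^ k) Ω₀c), ¬ inReg ((ℓ + 1) ^ k) Ωc x₁ →
          ∃ ν, D₀ ≤ |rpos ((ℓ + 1) ^ k) Ω₀c (incl hn hsub x) ν - rpos ((ℓ + 1) ^ k) Ω₀c x₁ ν|) →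
        (∀ x', P x' → ∀ x₁ : ↥(fineDom ((ℓ + 1) ^ k) Ω₀c), ¬ inReg ((ℓ + 1) ^ k) Ωc x₁ →
          ∃ ν, D₁ ≤ |rpos ((ℓ + 1) ^ k) Ω₀c x₁ ν - rpos ((ℓ + 1) ^ k) Ω₀c x' ν|) →
      ∀ (f : ↥(fineDom ((ℓ + 1) ^ k) Ω₀c) × ι → ℝ), (∀ p, ¬ P p.1 → f p = 0) →
      ∀ i : ι,
        |(regionDeriv F e ((ℓ + 1) ^ k) Ωc Ac μ
              *ᵥ ((regionOp F e hn (B1.aSeq a ((ℓ : ℝ) + 1) k) m2 Ωc Ac)⁻¹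
                *ᵥ (fun q : ↥(fineDom ((ℓ + 1) ^ k) Ωc) × ι => f (incl hn hsub q.1, q.2)))) (x, i)
          - (regionDeriv F e ((ℓ + 1) ^ k) Ω₀c Ac μ
              *ᵥ ((regionOp F e hn (B1.aSeq a ((ℓ : ℝ) + 1) k) m2 Ω₀c Ac)⁻¹ *ᵥ f)) (incl hn hsub x, i)|
          ≤ c₀ * Real.exp (-((D₀ + D₁) / (2 * ((((ℓ + 1) ^ k : ℕ) : ℝ) * K))))
            * Real.exp (-(D / (4 * ((((ℓ + 1) ^ k : ℕ) : ℝ) * K)))) * ‖f‖ := by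
  classical
  obtain ⟨K, hK8, h8, c₀, hc₀, H⟩ := thm112_deriv_region F hℓ₁ hLip d ℓ hℓ amin aplus m2plus ha
  have hK0 : (0 : ℝ) < K := by exact_mod_cast (show 0 < K by omega)
  set V : ℝ := max (Real.sqrt (Fintype.card ι)) 1 with hV
  have hV1 : (1 : ℝ) ≤ V := le_max_right _ _
  refine ⟨K, hK8, h8, c₀ * V * (2 * Real.exp (2 / (2 * K)) * max (latticeConst (d + 1) (1 / (2 * (2 * K)))) 1),
    by positivity, fun creg β hcreg hβ => ?_⟩
  obtain ⟨e₁, he₁, H'⟩ := H creg β hcreg hβ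
  refine ⟨e₁, he₁, ?_⟩
  intro k hk hn a m2 ha1 ha2 hm1 hm2 Ω₀c Ωc hΩ₀ hΩ hsub Ac e he hle h17 μ x hxμ hxR P D D₀ D₁ hD hD₀ hD₁ f hf i
  set NΩ := regionDeriv F e ((ℓ + 1) ^ k) Ωc Ac μ * (regionOp F e hn (B1.aSeq a ((ℓ : ℝ) + 1) k) m2 Ωc Ac)⁻¹
    with hNΩ
  set N₀ := regionDeriv F e ((ℓ + 1) ^ k) Ω₀c Ac μ * (regionOp F e hn (B1.aSeq a ((ℓ : ℝ) + 1) k) m2 Ω₀c Ac)⁻¹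
    with hN₀
  have hNΩg : ∀ g : ↥(fineDom ((ℓ + 1) ^ k) Ωc) × ι → ℝ, NΩ *ᵥ g = regionDeriv F e ((ℓ + 1) ^ k) Ωc Ac μ
      *ᵥ ((regionOp F e hn (B1.aSeq a ((ℓ : ℝ) + 1) k) m2 Ωc Ac)⁻¹ *ᵥ g) := by
    intro g; rw [hNΩ, ← Matrix.mulVec_mulVec]
  have hN₀g : ∀ g : ↥(fineDom ((ℓ + 1) ^ k) Ω₀c) × ι → ℝ, N₀ *ᵥ g = regionDeriv F e ((ℓ + 1) ^ k) Ω₀c Ac μ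
      *ᵥ ((regionOp F e hn (B1.aSeq a ((ℓ : ℝ) + 1) k) m2 Ω₀c Ac)⁻¹ *ᵥ g) := by
    intro g; rw [hN₀, ← Matrix.mulVec_mulVec]
  set φ : (↥(fineDom ((ℓ + 1) ^ k) Ω₀c) × ι → ℝ) → ℝ := fun g =>
    (NΩ *ᵥ fun q : ↥(fineDom ((ℓ + 1) ^ k) Ωc) × ι => g (incl hn hsub q.1, q.2)) (x, i) -
      (N₀ *ᵥ g) (incl hn hsub x, i) with hφ
  -- the fixed boundary factor rides in the constant of the unit-block bound
  set E : ℝ := Real.exp (-((D₀ + D₁) / (2 * ((((ℓ + 1) ^ k : ℕ) : ℝ) * K)))) with hE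
  have key := cubeSum_bound₂ hn (K := 2 * K) (by positivity) (c₀ := c₀ * V * E) (by positivity) φ
    (fun s g => by simp only [hφ]; exact pair_expr_sum NΩ N₀ (incl hn hsub) x i s g)
    (incl hn hsub x) (incl hn hsub x) P
    (fun y₀ D' _ hD1' _ g hg hgP => by
      have hgV : lpv (vol d ℓ k)⁻¹ 2 g ≤ V * ‖g‖ :=
        (lpv_two_le_unitBlock hn y₀ g hg).trans (mul_le_mul_of_nonneg_right (le_max_left _ _) (norm_nonneg g))
      -- r01's theorem at the predicate `blk = y₀ ∧ P`
      have h := H' k hk hn a m2 ha1 ha2 hm1 hm2 Ω₀c Ωc hΩ₀ hΩ hsub Ac e he hle h17 μ x hxμ hxR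
        (fun x'' => blk ((ℓ + 1) ^ k) x''.1 = y₀ ∧ P x'') D' D₀ D₁
        (fun x'' hx'' => hD1' x'' hx''.1) hD₀ (fun x'' hx'' => hD₁ x'' hx''.2) g
        (fun p hp => by
          by_cases hb : blk ((ℓ + 1) ^ k) p.1.1 = y₀
          · exact hgP p (fun hP => hp ⟨hb, hP⟩)
          · exact hg p hb) V hV1 hgV i
      have hexp : Real.exp (-((D' + D₀ + D₁) / (2 * ((((ℓ + 1) ^ k : ℕ) : ℝ) * K)))) =
          E * Real.exp (-(D' / ((((ℓ + 1) ^ k : ℕ) : ℝ) * (2 * K)))) := by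
        rw [hE, ← Real.exp_add]; congr 1; field_simp; ring
      rw [← hNΩg, ← hN₀g] at h
      calc |φ g| = _ := rfl
        _ ≤ c₀ * V * Real.exp (-((D' + D₀ + D₁) / (2 * ((((ℓ + 1) ^ k : ℕ) : ℝ) * K)))) * ‖g‖ := h
        _ = c₀ * V * E * Real.exp (-(D' / ((((ℓ + 1) ^ k : ℕ) : ℝ) * (2 * K)))) * ‖g‖ := by rw [hexp]; ring)
    D hD hD f hf
  have hrate : Real.exp (-(D / (2 * ((((ℓ + 1) ^ k : ℕ) : ℝ) * (2 * K))))) =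
      Real.exp (-(D / (4 * ((((ℓ + 1) ^ k : ℕ) : ℝ) * K)))) := by
    congr 1; ring
  rw [hrate] at key
  rw [← hNΩg, ← hN₀g]
  calc |φ f| ≤ c₀ * V * E * (2 * Real.exp (2 / (2 * K)) * max (latticeConst (d + 1) (1 / (2 * (2 * K)))) 1) *
        Real.exp (-(D / (4 * ((((ℓ + 1) ^ k : ℕ) : ℝ) * K)))) * ‖f‖ := key
    _ = c₀ * V * (2 * Real.exp (2 / (2 * K)) * max (latticeConst (d + 1) (1 / (2 * (2 * K)))) 1) * E *
        Real.exp (-(D / (4 * ((((ℓ + 1) ^ k : ℕ) : ℝ) * K)))) * ‖f‖ := by ring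

/-! ## §3  (1.9)·(1.12) for `δG_k`, Hölder member, all pairs, for an ARBITRARY `f` -/

/-- **THEOREM (1.11)–(1.12), HÖLDER member, ALL PAIRS `x ≠ x′`, GENERAL PAIR `Ω ⊂ Ω₀` UNDER `R₀`, ARBITRARY `f`** —
r01 g7's `B4Thm112RegionLpHolderAll.thm112_holder_region_all` freed of `‖f‖_{2,η} ≤ V‖f‖_∞` by the two-base-point cube
summation: for `0 ≤ α < 1` there are `K ≥ 16` (`8 ∣ K`) and `c₀ > 0` such that for every `(c, β)` there is `e₁ > 0`
with: for every `k ≥ 1`, `a ∈ [a₋,a₊]`, `m² ∈ [0,m²₊]`, every pair `Ω ⊆ Ω₀` of finite unions of `K`-blocks, every field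
regular (1.7) on `Ω₀` with `0 < e ≤ e₁`, every `μ`, every pair `x ≠ x′` in `Ω` with `x+e_μ, x′+e_μ ∈ Ω`, every
nearest-neighbour contour `Γ` from `x` to `x′` of length `≤ (d+1)|x′−x|_∞` within the sup-ball, `R₀` at `x` and at `x′`
(radius `K(d+4)`), EVERY `f : Ω₀ → ℝ^N` vanishing off `P` at `ℓ^∞`-distance `≥ D` from both points, `0 ≤ D₀ ≤` the
distances of `x` and `x′` to `Ω₀∖Ω`, `0 ≤ D₁ ≤ dist(P, Ω₀∖Ω)`:
`(η⁻¹/|x−x′|_∞)^α·|(U(D^η_{A,μ}u_Ω)(x′) − (D^η_{A,μ}u_Ω)(x) − (U(D^η_{A,μ}u₀)(x′) − (D^η_{A,μ}u₀)(x)))_i|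
 ≤ c₀·e^{−(D₀+D₁)/(2nK)}·e^{−D/(4nK)}·‖f‖_∞` — «(1.9) [for δG_k(Ω,Ω₀,A)] … with the additional factor (1.12)», for an
arbitrary `f`. [cite: Balaban1983RegularityDecay, Theorem p.573 (1.9), (1.11)–(1.12); §2 ¶1 p.575; proof p.579] -/
theorem thm112_holder_region_all_allF (F : OrthFlow ι) {ℓ₁ : ℝ} (hℓ₁ : 0 ≤ ℓ₁)
    (hLip : ∀ t (v : ι → ℝ), ((F.U t - 1) *ᵥ v) ⬝ᵥ ((F.U t - 1) *ᵥ v) ≤ (ℓ₁ * t) ^ 2 * (v ⬝ᵥ v))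
    (d ℓ : ℕ) (hℓ : 1 ≤ ℓ) (amin aplus m2plus : ℝ) (ha : 0 < amin) (α : ℝ) (hα0 : 0 ≤ α) (hα1 : α < 1) :
    ∃ K : ℕ, 16 ≤ K ∧ 8 ∣ K ∧ ∃ c₀ : ℝ, 0 < c₀ ∧ ∀ (creg β : ℝ), 0 ≤ creg → 0 < β →
      ∃ e₁ : ℝ, 0 < e₁ ∧ ∀ (k : ℕ), 1 ≤ k → ∀ (hn : 1 ≤ (ℓ + 1) ^ k) (a m2 : ℝ),
      amin ≤ a → a ≤ aplus → 0 ≤ m2 → m2 ≤ m2plus →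
      ∀ (Ω₀c Ωc : Finset (Fin (d + 1) → ℤ)), IsBlockUnion K Ω₀c → IsBlockUnion K Ωc → ∀ (hsub : Ωc ⊆ Ω₀c)
      (Ac : (Fin (d + 1) → ℤ) → Fin (d + 1) → ℝ) (e : ℝ), 0 < e → e ≤ e₁ →
        (∀ x ∈ fineDom ((ℓ + 1) ^ k) Ω₀c, ∀ μ ν : Fin (d + 1),
          |Ac (x + e1 μ) ν - Ac x ν| ≤ creg * e ^ (β - 1) / ((ℓ + 1) ^ k : ℕ)) →
      ∀ (μ : Fin (d + 1)) (x x' : ↥(fineDom ((ℓ + 1) ^ k) Ωc)), x.1 + e1 μ ∈ fineDom ((ℓ + 1) ^ k) Ωc →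
        x'.1 + e1 μ ∈ fineDom ((ℓ + 1) ^ k) Ωc → x'.1 ≠ x.1 →
      ∀ (l : List ↥(fineDom ((ℓ + 1) ^ k) Ωc)), IsNNChain x l → pathEnd x l = x' →
        (l.length : ℝ) ≤ ((d : ℝ) + 1) * supNorm (x'.1 - x.1) →
        (∀ z ∈ l, supNorm (z.1 - x.1) ≤ supNorm (x'.1 - x.1)) →
        (∀ y : Fin (d + 1) → ℤ, (∀ ν, |y ν - blk ((ℓ + 1) ^ k) x.1 ν| ≤ (K : ℤ) * (d + 4)) → y ∈ Ωc) →
        (∀ y : Fin (d + 1) → ℤ, (∀ ν, |y ν - blk ((ℓ + 1) ^ k) x'.1 ν| ≤ (K : ℤ) * (d + 4)) → y ∈ Ωc) →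
      ∀ (P : ↥(fineDom ((ℓ + 1) ^ k) Ω₀c) → Prop) (D D₀ D₁ : ℝ), 0 ≤ D₀ → 0 ≤ D₁ →
        (∀ x'', P x'' → ∃ ν, D ≤ |rpos ((ℓ + 1) ^ k) Ω₀c (incl hn hsub x) ν - rpos ((ℓ + 1) ^ k) Ω₀c x'' ν|) →
        (∀ x'', P x'' → ∃ ν, D ≤ |rpos ((ℓ + 1) ^ k) Ω₀c (incl hn hsub x') ν - rpos ((ℓ + 1) ^ k) Ω₀c x'' ν|) →
        (∀ x₁ : ↥(fineDom ((ℓ + 1) ^ k) Ω₀c), ¬ inReg ((ℓ + 1) ^ k) Ωc x₁ →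
          ∃ ν, D₀ ≤ |rpos ((ℓ + 1) ^ k) Ω₀c (incl hn hsub x) ν - rpos ((ℓ + 1) ^ k) Ω₀c x₁ ν|) →
        (∀ x₁ : ↥(fineDom ((ℓ + 1) ^ k) Ω₀c), ¬ inReg ((ℓ + 1) ^ k) Ωc x₁ →
          ∃ ν, D₀ ≤ |rpos ((ℓ + 1) ^ k) Ω₀c (incl hn hsub x') ν - rpos ((ℓ + 1) ^ k) Ω₀c x₁ ν|) →
        (∀ x'', P x'' → ∀ x₁ : ↥(fineDom ((ℓ + 1) ^ k) Ω₀c), ¬ inReg ((ℓ + 1) ^ k) Ωc x₁ →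
          ∃ ν, D₁ ≤ |rpos ((ℓ + 1) ^ k) Ω₀c x₁ ν - rpos ((ℓ + 1) ^ k) Ω₀c x'' ν|) →
      ∀ (f : ↥(fineDom ((ℓ + 1) ^ k) Ω₀c) × ι → ℝ), (∀ p, ¬ P p.1 → f p = 0) →
      ∀ i : ι,
        ((((ℓ + 1) ^ k : ℕ) : ℝ) / supNorm (x'.1 - x.1)) ^ α *
          |(transport (fieldLink F (e / ((ℓ + 1) ^ k : ℕ)) (acBond Ωc Ac)) x l
              *ᵥ fld (regionDeriv F e ((ℓ + 1) ^ k) Ωc Ac μ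
                    *ᵥ ((regionOp F e hn (B1.aSeq a ((ℓ : ℝ) + 1) k) m2 Ωc Ac)⁻¹
                      *ᵥ (fun q : ↥(fineDom ((ℓ + 1) ^ k) Ωc) × ι => f (incl hn hsub q.1, q.2)))) x'
            - fld (regionDeriv F e ((ℓ + 1) ^ k) Ωc Ac μ
                    *ᵥ ((regionOp F e hn (B1.aSeq a ((ℓ : ℝ) + 1) k) m2 Ωc Ac)⁻¹
                      *ᵥ (fun q : ↥(fineDom ((ℓ + 1) ^ k) Ωc) × ι => f (incl hn hsub q.1, q.2)))) x
            - (transport (fieldLink F (e / ((ℓ + 1) ^ k : ℕ)) (acBond Ωc Ac)) x l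
                *ᵥ fld (regionDeriv F e ((ℓ + 1) ^ k) Ω₀c Ac μ
                      *ᵥ ((regionOp F e hn (B1.aSeq a ((ℓ : ℝ) + 1) k) m2 Ω₀c Ac)⁻¹ *ᵥ f)) (incl hn hsub x')
              - fld (regionDeriv F e ((ℓ + 1) ^ k) Ω₀c Ac μ
                      *ᵥ ((regionOp F e hn (B1.aSeq a ((ℓ : ℝ) + 1) k) m2 Ω₀c Ac)⁻¹ *ᵥ f)) (incl hn hsub x))) i|
          ≤ c₀ * Real.exp (-((D₀ + D₁) / (2 * ((((ℓ + 1) ^ k : ℕ) : ℝ) * K))))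
            * Real.exp (-(D / (4 * ((((ℓ + 1) ^ k : ℕ) : ℝ) * K)))) * ‖f‖ := by
  classical
  obtain ⟨K, hK16, h8, c₀, hc₀, H⟩ := thm112_holder_region_all F hℓ₁ hLip d ℓ hℓ amin aplus m2plus ha α hα0 hα1
  have hK0 : (0 : ℝ) < K := by exact_mod_cast (show 0 < K by omega)
  set V : ℝ := max (Real.sqrt (Fintype.card ι)) 1 with hV
  have hV1 : (1 : ℝ) ≤ V := le_max_right _ _
  refine ⟨K, hK16, h8, c₀ * V * (2 * Real.exp (2 / (2 * K)) * max (latticeConst (d + 1) (1 / (2 * (2 * K)))) 1),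
    by positivity, fun creg β hcreg hβ => ?_⟩
  obtain ⟨e₁, he₁, H'⟩ := H creg β hcreg hβ
  refine ⟨e₁, he₁, ?_⟩
  intro k hk hn a m2 ha1 ha2 hm1 hm2 Ω₀c Ωc hΩ₀ hΩ hsub Ac e he hle h17 μ x x' hxμ hx'μ hne l hl hlend hlen hlnear hxR hx'R
    P D D₀ D₁ hD₀0 hD₁0 hD hD' hD₀ hD₀' hD₁ f hf i
  set T := transport (fieldLink F (e / ((ℓ + 1) ^ k : ℕ)) (acBond Ωc Ac)) x l with hT
  set NΩ := regionDeriv F e ((ℓ + 1) ^ k) Ωc Ac μ * (regionOp F e hn (B1.aSeq a ((ℓ : ℝ) + 1) k) m2 Ωc Ac)⁻¹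
    with hNΩ
  set N₀ := regionDeriv F e ((ℓ + 1) ^ k) Ω₀c Ac μ * (regionOp F e hn (B1.aSeq a ((ℓ : ℝ) + 1) k) m2 Ω₀c Ac)⁻¹
    with hN₀
  have hNΩg : ∀ g : ↥(fineDom ((ℓ + 1) ^ k) Ωc) × ι → ℝ, NΩ *ᵥ g = regionDeriv F e ((ℓ + 1) ^ k) Ωc Ac μ
      *ᵥ ((regionOp F e hn (B1.aSeq a ((ℓ : ℝ) + 1) k) m2 Ωc Ac)⁻¹ *ᵥ g) := by
    intro g; rw [hNΩ, ← Matrix.mulVec_mulVec]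
  have hN₀g : ∀ g : ↥(fineDom ((ℓ + 1) ^ k) Ω₀c) × ι → ℝ, N₀ *ᵥ g = regionDeriv F e ((ℓ + 1) ^ k) Ω₀c Ac μ
      *ᵥ ((regionOp F e hn (B1.aSeq a ((ℓ : ℝ) + 1) k) m2 Ω₀c Ac)⁻¹ *ᵥ g) := by
    intro g; rw [hN₀, ← Matrix.mulVec_mulVec]
  set w : ℝ := ((((ℓ + 1) ^ k : ℕ) : ℝ) / supNorm (x'.1 - x.1)) ^ α with hw
  have hw0 : 0 ≤ w := Real.rpow_nonneg (div_nonneg (Nat.cast_nonneg _) (supNorm_nonneg _)) α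
  set φ : (↥(fineDom ((ℓ + 1) ^ k) Ω₀c) × ι → ℝ) → ℝ := fun g =>
    w * ((T *ᵥ fld (NΩ *ᵥ fun q : ↥(fineDom ((ℓ + 1) ^ k) Ωc) × ι => g (incl hn hsub q.1, q.2)) x'
          - fld (NΩ *ᵥ fun q : ↥(fineDom ((ℓ + 1) ^ k) Ωc) × ι => g (incl hn hsub q.1, q.2)) x
          - (T *ᵥ fld (N₀ *ᵥ g) (incl hn hsub x') - fld (N₀ *ᵥ g) (incl hn hsub x))) i) with hφ
  have hφabs : ∀ g, |φ g| = w * |(T *ᵥ fld (NΩ *ᵥ fun q : ↥(fineDom ((ℓ + 1) ^ k) Ωc) × ι => g (incl hn hsub q.1, q.2)) x'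
          - fld (NΩ *ᵥ fun q : ↥(fineDom ((ℓ + 1) ^ k) Ωc) × ι => g (incl hn hsub q.1, q.2)) x
          - (T *ᵥ fld (N₀ *ᵥ g) (incl hn hsub x') - fld (N₀ *ᵥ g) (incl hn hsub x))) i| := by
    intro g; rw [hφ]; exact (abs_mul _ _).trans (by rw [abs_of_nonneg hw0])
  set E : ℝ := Real.exp (-((D₀ + D₁) / (2 * ((((ℓ + 1) ^ k : ℕ) : ℝ) * K)))) with hE
  have key := cubeSum_bound₂ hn (K := 2 * K) (by positivity) (c₀ := c₀ * V * E) (by positivity) φ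
    (fun s g => by simp only [hφ]; exact holder_pair_expr_sum w T NΩ N₀ (incl hn hsub) x x' i s g)
    (incl hn hsub x) (incl hn hsub x') P
    (fun y₀ D' hD0' hD1' hD2' g hg hgP => by
      have hgV : lpv (vol d ℓ k)⁻¹ 2 g ≤ V * ‖g‖ :=
        (lpv_two_le_unitBlock hn y₀ g hg).trans (mul_le_mul_of_nonneg_right (le_max_left _ _) (norm_nonneg g))
      have hsum : 0 ≤ D' + D₀ + D₁ := by positivity
      have h := H' k hk hn a m2 ha1 ha2 hm1 hm2 Ω₀c Ωc hΩ₀ hΩ hsub Ac e he hle h17 μ x x' hxμ hx'μ hne l hl hlend hlen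
        hlnear hxR hx'R (fun x'' => blk ((ℓ + 1) ^ k) x''.1 = y₀ ∧ P x'') D' D₀ D₁ hsum
        (fun x'' hx'' => hD1' x'' hx''.1) (fun x'' hx'' => hD2' x'' hx''.1) hD₀ hD₀'
        (fun x'' hx'' => hD₁ x'' hx''.2) g
        (fun p hp => by
          by_cases hb : blk ((ℓ + 1) ^ k) p.1.1 = y₀
          · exact hgP p (fun hP => hp ⟨hb, hP⟩)
          · exact hg p hb) V hV1 hgV i
      have hexp : Real.exp (-((D' + D₀ + D₁) / (2 * ((((ℓ + 1) ^ k : ℕ) : ℝ) * K)))) =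
          E * Real.exp (-(D' / ((((ℓ + 1) ^ k : ℕ) : ℝ) * (2 * K)))) := by
        rw [hE, ← Real.exp_add]; congr 1; field_simp; ring
      rw [← hNΩg, ← hN₀g] at h
      rw [hφabs]
      calc _ ≤ c₀ * V * Real.exp (-((D' + D₀ + D₁) / (2 * ((((ℓ + 1) ^ k : ℕ) : ℝ) * K)))) * ‖g‖ := h
        _ = c₀ * V * E * Real.exp (-(D' / ((((ℓ + 1) ^ k : ℕ) : ℝ) * (2 * K)))) * ‖g‖ := by rw [hexp]; ring)
    D hD hD' f hf
  have hrate : Real.exp (-(D / (2 * ((((ℓ + 1) ^ k : ℕ) : ℝ) * (2 * K))))) =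
      Real.exp (-(D / (4 * ((((ℓ + 1) ^ k : ℕ) : ℝ) * K)))) := by
    congr 1; ring
  rw [hrate, hφabs] at key
  rw [← hNΩg, ← hN₀g]
  calc _ ≤ c₀ * V * E * (2 * Real.exp (2 / (2 * K)) * max (latticeConst (d + 1) (1 / (2 * (2 * K)))) 1) *
        Real.exp (-(D / (4 * ((((ℓ + 1) ^ k : ℕ) : ℝ) * K)))) * ‖f‖ := key
    _ = c₀ * V * (2 * Real.exp (2 / (2 * K)) * max (latticeConst (d + 1) (1 / (2 * (2 * K)))) 1) * E *
        Real.exp (-(D / (4 * ((((ℓ + 1) ^ k : ℕ) : ℝ) * K)))) * ‖f‖ := by ring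

end

end Literature.MathematicalPhysics.QuantumFieldTheory.Balaban1983to89.B4Thm112RegionAllF
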